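import Summits.QuantumAdvantage.AdviceFreeQNC0.WalkFullExactLawIff
import HarnessLib

/-!
# Cell qa-qnc0 (rung F-Q1, route RingFrame, crux α `RingToElim`): the ELIMINATION MODULE —
# `𝔽₄ = 𝔽₂ω^c ⊕ 𝔽₂ω^{c'}`, decomposition of low-degree `𝔽₄`-polynomials along it, reconstruction
# from a conjugation-covering family, and `span{χ_a : #₂(a) ≤ D} ≤ 𝔽₄[u]_{≤D}·χ_{1^n}`

Toolkit for the upper half of the RING EXACT LAW (`WalkRingExactLaw.lean`: perfect ring play
exists for `n ≤ 2D+1` at every charge `c ≢ n (mod 3)`), over `WalkSupportLemma.lean` /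
`WalkFullExactLawIff.lean` (planner qa-qnc0-p1 TARGET §15.1–15.3; "ELIMINATION = the sub-case
supported at `g ∈ {0, n}`: `𝒯^elim_D = Tr(M_D({1ⁿ}))`"):

* `F4.exists_bits_of_ne` — `{ω^c, ω^{c'}}` is an `𝔽₂`-basis of `𝔽₄` when `c ≢ c' (mod 3)`
  (from `F4.exists_eq_add_mul_omega`); **`polySpan_decomp`** — every `F ∈ 𝔽₄[u]_{≤D}` is
  `A·ω^c + B·ω^{c'}` with `A, B ∈ 𝔽₂[u]_{≤D}` (span induction);
* **`exists_chiSpan_tr_eq`** — the reconstruction theorem of `WalkSupportLemma.lean` for an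
  ARBITRARY family `Q` of patterns: `h² = h` and `L_a(h) = 0` whenever `¬Q a ∧ ¬Q ā` give
  `h = tr f` with `f ∈ span{χ_a : Q a}` (representatives of conjugate pairs by the letter at
  position `0`, inversion `sum_Lfun_mul_chi`);
* **`chiSpan_ball_le`** — `span{χ_a : dist(a, 1ⁿ) ≤ D} ≤ 𝔽₄[u]_{≤D} · χ_{1ⁿ}` (Möbius,
  `chi_flipOn_mem_span`): the elimination module.

The cell's lemmas (prover qn-prover-3 gen 6), 2026-08-27; standard, not in print in this form.
WHAT THIS IS NOT: no game statement (see `WalkRingExactLaw.lean`); no separation claim.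
-/

noncomputable section

namespace Summit.QuantumAdvantage.AdviceFreeQNC0

open Finset
open Literature.Computability.MetaComplexity Literature.Computability.MetaComplexity.Smolensky
open F4


/-! ### Two distinct powers of `ω` form an `𝔽₂`-basis of `𝔽₄` -/

/-- `1`, `ω`, `ω²` in terms of two distinct powers. -/
private theorem F4.one_omega_bits (c c' : ℕ) (hcc : c % 3 ≠ c' % 3) :
    (∃ s t : ZMod 2, (1 : F4) = algebraMap (ZMod 2) F4 s * ω ^ c + algebraMap (ZMod 2) F4 t * ω ^ c') ∧
      ∃ s t : ZMod 2, ω = algebraMap (ZMod 2) F4 s * ω ^ c + algebraMap (ZMod 2) F4 t * ω ^ c' := by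
  rw [omega_pow_mod c, omega_pow_mod c']
  have h1 := omega_add_omega_sq
  have hc : c % 3 = 0 ∨ c % 3 = 1 ∨ c % 3 = 2 := by omega
  have hc' : c' % 3 = 0 ∨ c' % 3 = 1 ∨ c' % 3 = 2 := by omega
  rcases hc with hc | hc | hc <;> rcases hc' with hc' | hc' | hc' <;> rw [hc, hc'] <;>
    simp only [hc, hc'] at hcc <;> (try exact absurd rfl hcc) <;> constructor
  -- (0,1)
  · exact ⟨1, 0, by simp⟩
  · exact ⟨0, 1, by simp⟩
  -- (0,2)
  · exact ⟨1, 0, by simp⟩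
  · exact ⟨1, 1, by simp; linear_combination -h1 + (ω - 1) * two_eq_zero⟩
  -- (1,0)
  · exact ⟨0, 1, by simp⟩
  · exact ⟨1, 0, by simp⟩
  -- (1,2)
  · exact ⟨1, 1, by simp; linear_combination -h1⟩
  · exact ⟨1, 0, by simp⟩
  -- (2,0)
  · exact ⟨0, 1, by simp⟩
  · exact ⟨1, 1, by simp; linear_combination -h1 + (ω - 1) * two_eq_zero⟩
  -- (2,1)
  · exact ⟨1, 1, by simp; linear_combination -h1⟩
  · exact ⟨0, 1, by simp⟩

/-- **`{ω^c, ω^{c'}}` is an `𝔽₂`-basis of `𝔽₄`** for `c ≢ c' (mod 3)`. -/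
theorem F4.exists_bits_of_ne (c c' : ℕ) (hcc : c % 3 ≠ c' % 3) (x : F4) :
    ∃ s t : ZMod 2, x = algebraMap (ZMod 2) F4 s * ω ^ c + algebraMap (ZMod 2) F4 t * ω ^ c' := by
  obtain ⟨a, b, rfl⟩ := F4.exists_eq_add_mul_omega x
  obtain ⟨⟨s₁, t₁, h₁⟩, ⟨s₂, t₂, h₂⟩⟩ := F4.one_omega_bits c c' hcc
  refine ⟨a * s₁ + b * s₂, a * t₁ + b * t₂, ?_⟩
  have e : algebraMap (ZMod 2) F4 a + algebraMap (ZMod 2) F4 b * ω =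
      algebraMap (ZMod 2) F4 a * (algebraMap (ZMod 2) F4 s₁ * ω ^ c + algebraMap (ZMod 2) F4 t₁ * ω ^ c') +
        algebraMap (ZMod 2) F4 b * (algebraMap (ZMod 2) F4 s₂ * ω ^ c + algebraMap (ZMod 2) F4 t₂ * ω ^ c') := by
    rw [← h₁, ← h₂, mul_one]
  rw [e]
  simp only [map_add, map_mul]
  ring

/-! ### Decomposition of low-degree `𝔽₄`-polynomials along the basis -/

variable {n : ℕ}

/-- **`𝔽₄[u]_{≤D} = 𝔽₂[u]_{≤D}·ω^c ⊕ 𝔽₂[u]_{≤D}·ω^{c'}`** for `c ≢ c' (mod 3)`. -/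
theorem polySpan_decomp {c c' : ℕ} (hcc : c % 3 ≠ c' % 3) {D : ℕ} {F : (Fin n → Bool) → F4}
    (hF : F ∈ polySpan n D) :
    ∃ A B : CubeFn (ZMod 2) n, A ∈ lowDeg (ZMod 2) n D ∧ B ∈ lowDeg (ZMod 2) n D ∧
      F = fun u => algebraMap (ZMod 2) F4 (A u) * ω ^ c + algebraMap (ZMod 2) F4 (B u) * ω ^ c' := by
  classical
  unfold polySpan at hF
  induction hF using Submodule.span_induction with
  | mem G hG =>
    obtain ⟨S, hS, rfl⟩ := hG
    obtain ⟨s, t, h1⟩ := F4.exists_bits_of_ne c c' hcc 1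
    refine ⟨s • mono (ZMod 2) S, t • mono (ZMod 2) S, Submodule.smul_mem _ _ (mono_mem_lowDeg hS),
      Submodule.smul_mem _ _ (mono_mem_lowDeg hS), ?_⟩
    funext u
    have hm : algebraMap (ZMod 2) F4 (mono (ZMod 2) S u) = monoF S u := by
      unfold mono monoF ιF
      rw [map_prod]
      refine Finset.prod_congr rfl fun i _ => ?_
      by_cases h : u i = true <;> simp [h]
    simp only [Pi.smul_apply, smul_eq_mul, map_mul, hm]
    calc monoF S u = monoF S u * 1 := (mul_one _).symm
      _ = _ := by rw [h1]; ring
  | zero =>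
    refine ⟨0, 0, Submodule.zero_mem _, Submodule.zero_mem _, ?_⟩
    funext u; simp
  | add G H _ _ hG hH =>
    obtain ⟨A₁, B₁, hA₁, hB₁, rfl⟩ := hG
    obtain ⟨A₂, B₂, hA₂, hB₂, rfl⟩ := hH
    refine ⟨A₁ + A₂, B₁ + B₂, Submodule.add_mem _ hA₁ hA₂, Submodule.add_mem _ hB₁ hB₂, ?_⟩
    funext u
    simp only [Pi.add_apply, map_add]
    ring
  | smul r G _ hG =>
    obtain ⟨A, B, hA, hB, rfl⟩ := hG
    obtain ⟨s₁, t₁, h₁⟩ := F4.exists_bits_of_ne c c' hcc (r * ω ^ c)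
    obtain ⟨s₂, t₂, h₂⟩ := F4.exists_bits_of_ne c c' hcc (r * ω ^ c')
    refine ⟨s₁ • A + s₂ • B, t₁ • A + t₂ • B,
      Submodule.add_mem _ (Submodule.smul_mem _ _ hA) (Submodule.smul_mem _ _ hB),
      Submodule.add_mem _ (Submodule.smul_mem _ _ hA) (Submodule.smul_mem _ _ hB), ?_⟩
    funext u
    simp only [Pi.smul_apply, Pi.add_apply, smul_eq_mul, map_add, map_mul]
    calc r * (algebraMap (ZMod 2) F4 (A u) * ω ^ c + algebraMap (ZMod 2) F4 (B u) * ω ^ c')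
        = algebraMap (ZMod 2) F4 (A u) * (r * ω ^ c) + algebraMap (ZMod 2) F4 (B u) * (r * ω ^ c') := by
          ring
      _ = _ := by rw [h₁, h₂]; ring

/-! ### Reconstruction from a conjugation-covering family -/

variable {m : ℕ}

/-- **Reconstruction** (as in `exists_fullSpan_tr_eq`, for a general family `Q` of patterns): a
function `h` with `h² = h` whose coefficients vanish at every pattern `a` with `¬Q a` and `¬Q ā`
is `tr f` for some `f ∈ span{χ_a : Q a}`. -/
theorem exists_chiSpan_tr_eq (Q : (Fin m → Bool) → Prop) (h : (Fin m → Bool) → F4)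
    (hh : ∀ u, h u ^ 2 = h u) (hfar : ∀ a : Fin m → Bool, ¬ Q a → ¬ Q (conj a) → Lfun a h = 0) :
    ∃ f ∈ chiSpan Q, ∀ u, tr (f u) = h u := by
  classical
  rcases Nat.eq_zero_or_pos m with hm | hm
  · subst hm
    set u₀ : Fin 0 → Bool := fun i => Fin.elim0 i with hu₀
    have hall : ∀ u : Fin 0 → Bool, u = u₀ := fun u => funext fun i => Fin.elim0 i
    by_cases hQ : Q u₀
    · refine ⟨fun u => ω * h u, ?_, fun u => ?_⟩
      · have e : (fun u : Fin 0 → Bool => ω * h u) = (ω * h u₀) • chi u₀ := by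
          funext u
          rw [hall u, Pi.smul_apply, smul_eq_mul]
          unfold chi
          simp
        rw [e]
        exact Submodule.smul_mem _ _ (chi_mem_chiSpan hQ)
      · unfold tr
        rw [mul_pow, hh u, ← add_mul, omega_add_omega_sq, one_mul]
    · have hconj : conj u₀ = u₀ := hall _
      have hz : Lfun u₀ h = 0 := hfar u₀ hQ (by rw [hconj]; exact hQ)
      have hh0 : h u₀ = 0 := by
        rw [← sum_Lfun_mul_chi h u₀]
        refine Finset.sum_eq_zero fun a _ => ?_
        rw [hall a, hz, zero_mul]
      refine ⟨0, Submodule.zero_mem _, fun u => ?_⟩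
      rw [hall u, hh0]
      exact tr_zero
  · set i₀ : Fin m := ⟨0, hm⟩ with hi₀
    set R : Finset (Fin m → Bool) :=
      univ.filter fun a => Q a ∧ (Q (conj a) → a i₀ = false) with hR
    set f : (Fin m → Bool) → F4 := fun u => ∑ a ∈ R, Lfun a h * chi a u with hf
    refine ⟨f, ?_, fun u => ?_⟩
    · have e : f = ∑ a ∈ R, (Lfun a h • chi a) := by
        funext u; simp only [hf, Finset.sum_apply, Pi.smul_apply, smul_eq_mul]
      rw [e]
      refine Submodule.sum_mem _ fun a ha => Submodule.smul_mem _ _ ?_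
      exact chi_mem_chiSpan (Finset.mem_filter.1 ha).2.1
    · have hsq : f u ^ 2 = ∑ a ∈ R, Lfun (conj a) h * chi (conj a) u := by
        rw [hf]
        dsimp only
        rw [show (∑ a ∈ R, Lfun a h * chi a u) ^ 2 = ∑ a ∈ R, (Lfun a h * chi a u) ^ 2 from by
          induction R using Finset.induction_on with
          | empty => simp
          | insert j s hj ih => rw [Finset.sum_insert hj, Finset.sum_insert hj, add_sq', ih]]
        refine Finset.sum_congr rfl fun a _ => ?_
        rw [mul_pow, Lfun_sq, chi_sq]
        congr 1
        exact congrArg (Lfun (conj a)) (funext hh)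
      have hexcl : ∀ a, a ∈ R → conj a ∈ R → False := by
        intro a ha ha'
        rw [hR, Finset.mem_filter] at ha ha'
        rw [conj_conj] at ha'
        have h1 := ha.2.2 ha'.2.1
        have h2 := ha'.2.2 ha.2.1
        simp [conj, h1] at h2
      have hzero : ∀ a, a ∉ R → conj a ∉ R → Lfun a h * chi a u = 0 := by
        intro a ha ha'
        have hna : ¬ Q a := by
          intro hna
          have h1 : Q (conj a) ∧ a i₀ ≠ false := by
            by_contra hcon
            apply ha
            rw [hR, Finset.mem_filter]
            refine ⟨Finset.mem_univ _, hna, fun hc => ?_⟩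
            by_contra hai
            exact hcon ⟨hc, hai⟩
          apply ha'
          rw [hR, Finset.mem_filter]
          refine ⟨Finset.mem_univ _, h1.1, fun _ => ?_⟩
          show (!a i₀) = false
          cases hx : a i₀
          · exact absurd hx h1.2
          · rfl
        have hnc : ¬ Q (conj a) := by
          intro hnc
          apply ha'
          rw [hR, Finset.mem_filter]
          refine ⟨Finset.mem_univ _, hnc, fun hca => ?_⟩
          rw [conj_conj] at hca
          exact absurd hca hna
        rw [hfar a hna hnc, zero_mul]
      have hsplit : ∀ a : Fin m → Bool, Lfun a h * chi a u =
          (if a ∈ R then Lfun a h * chi a u else 0) + (if conj a ∈ R then Lfun a h * chi a u else 0) := by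
        intro a
        by_cases h1 : a ∈ R
        · rw [if_pos h1, if_neg (fun h2 => hexcl a h1 h2), add_zero]
        · by_cases h2 : conj a ∈ R
          · rw [if_neg h1, if_pos h2, zero_add]
          · rw [if_neg h1, if_neg h2, add_zero, hzero a h1 h2]
      have htot := sum_Lfun_mul_chi h u
      rw [Finset.sum_congr rfl fun a _ => hsplit a, Finset.sum_add_distrib, Finset.sum_ite_mem,
        Finset.univ_inter] at htot
      have hconj : ∑ a : Fin m → Bool, (if conj a ∈ R then Lfun a h * chi a u else 0) =
          ∑ a ∈ R, Lfun (conj a) h * chi (conj a) u := by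
        have hinv : Function.Involutive (conj (m := m)) := conj_conj
        rw [← Equiv.sum_comp hinv.toPerm (fun a => if conj a ∈ R then Lfun a h * chi a u else 0)]
        simp only [Function.Involutive.coe_toPerm, conj_conj]
        rw [Finset.sum_ite_mem, Finset.univ_inter]
      rw [hconj] at htot
      unfold tr
      rw [hsq, ← htot]

/-! ### The elimination module -/

/-- `span{χ_a : #₂(a) ≤ D} ≤ 𝔽₄[u]_{≤D} · χ_{1^n}`: every character within distance `D` of the
all-`1` pattern is a low-degree polynomial times `χ_{1^n} = ω^{|u|}`. -/
theorem chiSpan_ball_le (n D : ℕ) :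
    chiSpan (fun a : Fin n → Bool => pdist a (aPat 0) ≤ D) ≤
      (polySpan n D).map (LinearMap.mulRight F4 (chi (aPat (m := n) 0))) := by
  classical
  unfold chiSpan
  refine Submodule.span_le.2 ?_
  rintro f ⟨a, ha, rfl⟩
  set T := misSet (aPat (m := n) 0) a with hT
  have hflip : flipOn T (aPat 0) = a := (flipOn_eq_iff T (aPat 0) a).2 hT
  have hcard : T.card ≤ D := by rw [hT, card_misSet, pdist_comm]; exact ha
  rw [SetLike.mem_coe, ← hflip]
  have h := chi_flipOn_mem_span T (aPat (m := n) 0)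
  refine (Submodule.span_le.2 ?_) h
  rintro g ⟨S, hS, rfl⟩
  refine Submodule.mem_map.2 ⟨monoF S, Submodule.subset_span ⟨S, (Finset.card_le_card hS).trans hcard, rfl⟩, ?_⟩
  funext u
  rfl

end Summit.QuantumAdvantage.AdviceFreeQNC0

end
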